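import Mathlib
import Literature.MathematicalPhysics.QuantumFieldTheory.Balaban1983to89.B12Average012Analytic
import Literature.MathematicalPhysics.QuantumFieldTheory.Balaban1983to89.B12Average012Covariance
import Literature.MathematicalPhysics.QuantumFieldTheory.Balaban1983to89.B12Average012Periodicity

/-!
# `Balaban1983to89.B12Average012QtildeCovariance` — [Balaban1987RG1] (2.4), (2.16), (2.17), p. 267: the function
# `Q̃_V(B′)` of the b12 lineage's actual average and its LINEAR PART `LQ̃` are COVARIANT under the gauge
# transformations (2.16) (`LQ̃_{V^u}(R(u)B′) = u(Lc₋)LQ̃_V(B′)u(Lc₋)⁻¹`) and under the lattice translations (2.17)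
# (`Q̃_{τ_{La}V}(τ_{La}B′)(c) = Q̃_V(B′)(c + a)`, same for `LQ̃`) — PROVED

HONEST FRAMING (cell `lit-balaban`, verbatim): statement-level skeleton of published theorems with citation tags;
proofs where landed; nothing here is a claim about the Yang–Mills mass gap.

CITATION HEADER.  T. Bałaban, *Renormalization group approach to lattice gauge field theories. I*, Commun. Math.
Phys. **109** (1987) 249–301, doi:10.1007/bf01215223 [Balaban1987RG1] (cell paper B12 = «[I]»): (2.4) p. 266, p. 267
(«LQ̃B′ + C̃(B′)»), (2.16)–(2.17) p. 269 («all the expressions in (2.12), together with the measure, are invariant with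
respect to the gauge transformations U_{k+1} → U^u_{k+1}, B′ → R(u)B′ … Now consider a Euclidean symmetry r … (rU)(b)
= U(rb) (2.17). By their definitions the expressions in (2.1) are invariant with respect to these transformations.»);
p. 269 [PDF 21] re-read this generation from the held text `paper:balaban1987-cmp109-rg-i-small-field`.  Unit
`lit-balaban-r09` gen 9 (display owner of CMP 109; TAKING line `HOME/STATUS.md` 2026-08-21T09:5xZ), HOME
`run/shared/lean/pub/lit-balaban/`; SKELETON rows `B12.Eq2.4`, `B12.Eq2.16`, `B12.Eq2.17-2.18`, `B12.Def@267` (cells only).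

DICTIONARY print → Lean (all PRE-EXISTING).  `Q̃_V(B′)(c)` ↦ `B12AverageCorridor267.Qtilde L 𝐔 V B′ c` for the family
(0.11) `𝐔 = B12ContourAverage253.Tavg`; `LQ̃` ↦ `B12AverageCorridor267.LQ` (derivative along `s ↦ sB′`); `V^u` ↦
`QuantumLattice.gaugeTransformZd u V`; `R(u)B′` ↦ `B12Average012Covariance.rotB u B′`; `τ_v` ↦
`B12Average012Periodicity.shiftE v`.

THE ARGUMENT FORMALISED.  (2.16): the finite identity `Q̃_{V^u}(R(u)B′) = u(Lc₋)Q̃_V(B′)u(Lc₋)⁻¹`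
(`B12Average012Covariance.Qtilde_gaugeTransformZd`) needs the perturbed loops and the ratio `Ū(V′V)Ū(V)⁻¹` inside
the logarithm's domain; along `s ↦ sB′` these are continuous in `s` (indeed analytic: `B12Average012Analytic`) and
strictly inside at `s = 0` for a regular `V`, hence inside for all small `s` (`ContinuousAt.eventually_lt`, finitely
many loops), so the two sides of the identity agree on a neighbourhood of `s = 0` and have the same derivative there
(`Filter.EventuallyEq.deriv_eq`); the right side's derivative is `u·LQ̃_V(B′)·u⁻¹` by `hasDerivAt_Qtilde_line`.
(2.17): `τ(V′)τ(V) = τ(V′V)` and `\overline{τ_{La}U} = τ_aŪ` (`B12Average012Periodicity.avgBar_shiftE`) give the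
exact covariance of `Q̃`, and of `LQ̃` by unfolding.

WHAT IS PROVED (kernel-checked, no `sorry`, axioms `propext`, `Classical.choice`, `Quot.sound`; NO definition, NO `Prop`
placeholder, net new unproved facts 0): `rotB_smul`, **`LQ_gaugeTransformZd`**, `pert_shiftE`, **`Qtilde_shiftE`**,
**`LQ_shiftE`**.

DIVERGENCES FROM PRINT / WHAT IS NOT PROVED (honest scope).  (a) (2.16) for `LQ̃` at `U1`-valued `ε₀`-regular `V`,
`(dL)²ε₀ < 1/100`, `d ≥ 1`, `U1`-valued `u`; the identity for `Q̃` itself at finite `B′` is the tree's, under its loop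
hypotheses.  (b) Translations only among the Euclidean transformations (2.17)–(2.18) (as `B12Average012Periodicity`
(a)).  (c) `ℤᵈ` corner cubes and the lineage's (0.10)–(0.12).
-/

noncomputable section

open NormedSpace Finset Filter

namespace Literature.MathematicalPhysics.QuantumFieldTheory.Balaban1983to89.B12Average012QtildeCovariance

open _root_.Topology
open Literature.MathematicalPhysics.QuantumLattice (ZdEdge blockBase blockSites mem_blockSites_iff plaquetteHolonomyZd
  gaugeTransformZd)
open B7Prop1Explicit (U1 mem_U1)
open B12AverageCorridor267 (loopW offAxis pert pert_zero Qtilde LQ)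
open B12ContourAverage253 (Tavg omegaA norm_loopW_Tavg_sub_one_le_local)
open B12SmallFieldRegion255 (avgBar)
open B12Average012Covariance (rotB rotB_apply Qtilde_gaugeTransformZd)
open B12Average012Analytic (analyticAt_pert analyticAt_loopW_Tavg analyticAt_avgBar hasDerivAt_Qtilde_line)
open B12Average012Periodicity (shiftE shiftE_apply avgBar_shiftE)

variable {d : ℕ}
variable {𝔸 : Type*} [NormedRing 𝔸] [NormedAlgebra ℂ 𝔸] [NormOneClass 𝔸] [CompleteSpace 𝔸] {L : ℕ}

omit [NormOneClass 𝔸] [CompleteSpace 𝔸] in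
/-- [cite: Balaban1987RG1, (2.16) p.269] the rotation `R(u)` of (2.16) is linear: `R(u)(sB′) = sR(u)B′` (elementary API). -/
theorem rotB_smul (v : (Fin d → ℤ) → 𝔸ˣ) (s : ℂ) (B' : ZdEdge d → 𝔸) : rotB v (s • B') = s • rotB v B' := by
  funext b
  simp only [rotB_apply, Pi.smul_apply, mul_smul_comm, smul_mul_assoc]

/-- [cite: Balaban1987RG1, (2.16) p.269][cite: Balaban1987RG1, p.267] **THE LINEAR PART `LQ̃` OF (2.4) IS COVARIANT
UNDER THE GAUGE TRANSFORMATIONS (2.16)** `V^{(k)} ↦ (V^{(k)})^u`, `B′ ↦ R(u)B′`, for [I]'s actual (0.12)/(0.11) average: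
`LQ̃_{V^u}(R(u)B′)(c) = u(Lc₋)·LQ̃_V(B′)(c)·u(Lc₋)⁻¹` at every `U1`-valued `ε₀`-regular `V` with `(dL)²ε₀ < 1/100`
(`d ≥ 1`) and every `U1`-valued `u` — the derivative at `s = 0` of the finite identity
`Q̃_{V^u}(sR(u)B′) = u(Lc₋)Q̃_V(sB′)u(Lc₋)⁻¹` (`B12Average012Covariance.Qtilde_gaugeTransformZd`), which holds for
all small `s` because the perturbed loops and the ratio `Ū(V′V)Ū(V)⁻¹` depend continuously (indeed analytically,
`B12Average012Analytic`) on `s` and lie strictly inside the logarithm's domain at `s = 0`. -/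
theorem LQ_gaugeTransformZd (hL : 0 < L) (hd : 1 ≤ d) (V : ZdEdge d → 𝔸ˣ) (hV : ∀ b, V b ∈ U1 𝔸)
    {v : (Fin d → ℤ) → 𝔸ˣ} (hv : ∀ z, v z ∈ U1 𝔸) {ε₀ : ℝ} (hε₀ : 0 ≤ ε₀)
    (hsm : ((d : ℝ) * L) ^ 2 * ε₀ < 1 / 100)
    (h44 : ∀ (p : Fin d → ℤ) (i j : Fin d), i ≠ j → ‖((plaquetteHolonomyZd V p i j : 𝔸ˣ) : 𝔸) - 1‖ ≤ ε₀)
    (B' : ZdEdge d → 𝔸) (c : ZdEdge d) :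
    LQ L (fun U : ZdEdge d → 𝔸ˣ => Tavg L U) (gaugeTransformZd v V) (rotB v B') c
      = (v (blockBase L c.1) : 𝔸) * LQ L (fun U : ZdEdge d → 𝔸ˣ => Tavg L U) V B' c
          * (((v (blockBase L c.1))⁻¹ : 𝔸ˣ) : 𝔸) := by
  haveI : NeZero L := ⟨hL.ne'⟩
  -- the analytic line `s ↦ V′_sV`, `V′_s = exp(isB′)`
  set U : ℂ → ZdEdge d → 𝔸ˣ := fun s => pert (s • B') V with hUdef
  have hU : ∀ b, AnalyticAt ℂ (fun s : ℂ => ((U s b : 𝔸ˣ) : 𝔸)) 0 :=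
    analyticAt_pert (fun s : ℂ => s • B') (fun b => analyticAt_id.smul analyticAt_const) V
  have hU0 : U 0 = V := by simp only [hUdef, zero_smul, pert_zero]
  have hU1 : ∀ b, U 0 b ∈ U1 𝔸 := fun b => by rw [hU0]; exact hV b
  have h44' : ∀ (p : Fin d → ℤ) (i j : Fin d), i ≠ j →
      ‖((plaquetteHolonomyZd (U 0) p i j : 𝔸ˣ) : 𝔸) - 1‖ ≤ ε₀ := by rw [hU0]; exact h44
  -- the unperturbed off-axis loops lie in the logarithm's domain
  have hW0 : ∀ x ∈ offAxis L c, ‖((loopW L (fun U : ZdEdge d → 𝔸ˣ => Tavg L U) V c x : 𝔸ˣ) : 𝔸) - 1‖ < 1 := by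
    intro x hx
    have hxB : x ∈ blockSites L c.1 := (Finset.mem_filter.1 hx).1
    have h := norm_loopW_Tavg_sub_one_le_local hL hd V (fun b => (mem_U1.mp (hV b)).1)
      (fun b => (mem_U1.mp (hV b)).2) hε₀ hsm.le c (fun p i j hij _ _ => h44 p i j hij) hxB
    have hω : omegaA d L ε₀ < 1 := by unfold omegaA; linarith
    exact h.trans_lt hω
  -- for small `s` the perturbed loops and the ratio stay in the domain
  have hWs : ∀ᶠ s : ℂ in 𝓝 0, ∀ x ∈ offAxis L c,
      ‖((loopW L (fun U : ZdEdge d → 𝔸ˣ => Tavg L U) (U s) c x : 𝔸ˣ) : 𝔸) - 1‖ < 1 := by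
    rw [eventually_all_finset]
    intro x hx
    have hc : ContinuousAt (fun s : ℂ =>
        ‖((loopW L (fun U : ZdEdge d → 𝔸ˣ => Tavg L U) (U s) c x : 𝔸ˣ) : 𝔸) - 1‖) 0 :=
      ((analyticAt_loopW_Tavg U hU hL hU1 hε₀ hsm h44' c x).continuousAt.sub continuousAt_const).norm
    have h0 : ‖((loopW L (fun U : ZdEdge d → 𝔸ˣ => Tavg L U) (U 0) c x : 𝔸ˣ) : 𝔸) - 1‖ < 1 := by
      rw [hU0]; exact hW0 x hx
    exact hc.eventually_lt continuousAt_const h0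
  have hQs : ∀ᶠ s : ℂ in 𝓝 0,
      ‖((avgBar L (U s) c * (avgBar L V c)⁻¹ : 𝔸ˣ) : 𝔸) - 1‖ < 1 := by
    have hc : ContinuousAt (fun s : ℂ => ‖((avgBar L (U s) c * (avgBar L V c)⁻¹ : 𝔸ˣ) : 𝔸) - 1‖) 0 := by
      have ha := (analyticAt_avgBar U hU hL hd hU1 hε₀ hsm h44' c).continuousAt
      simp only [Units.val_mul]
      exact ((ha.mul continuousAt_const).sub continuousAt_const).norm
    have h0 : ‖((avgBar L (U 0) c * (avgBar L V c)⁻¹ : 𝔸ˣ) : 𝔸) - 1‖ < 1 := by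
      rw [hU0, mul_inv_cancel, Units.val_one, sub_self, norm_zero]; exact one_pos
    exact hc.eventually_lt continuousAt_const h0
  -- the finite covariance identity holds for all small `s`
  have hev : (fun s : ℂ => Qtilde L (fun U : ZdEdge d → 𝔸ˣ => Tavg L U) (gaugeTransformZd v V) (s • rotB v B') c)
      =ᶠ[𝓝 0] fun s : ℂ => (v (blockBase L c.1) : 𝔸)
        * Qtilde L (fun U : ZdEdge d → 𝔸ˣ => Tavg L U) V (s • B') c * (((v (blockBase L c.1))⁻¹ : 𝔸ˣ) : 𝔸) := by
    filter_upwards [hWs, hQs] with s hW' hQ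
    rw [← rotB_smul]
    exact Qtilde_gaugeTransformZd hL hv (s • B') V c hW0 hW' hQ
  -- differentiate at `s = 0`
  have hder : HasDerivAt (fun s : ℂ => (v (blockBase L c.1) : 𝔸)
        * Qtilde L (fun U : ZdEdge d → 𝔸ˣ => Tavg L U) V (s • B') c * (((v (blockBase L c.1))⁻¹ : 𝔸ˣ) : 𝔸))
      ((v (blockBase L c.1) : 𝔸) * LQ L (fun U : ZdEdge d → 𝔸ˣ => Tavg L U) V B' c
        * (((v (blockBase L c.1))⁻¹ : 𝔸ˣ) : 𝔸)) 0 :=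
    ((hasDerivAt_Qtilde_line hL hd V hV hε₀ hsm h44 B' c).const_mul _).mul_const _
  unfold LQ
  rw [hev.deriv_eq]
  exact hder.deriv

/-! ## Translations (2.17): `Q̃` and `LQ̃` are translation covariant (exactly, no domain condition) -/

omit [NormOneClass 𝔸] in
/-- [cite: Balaban1987RG1, (2.17) p.269] `(τ_v V′)(τ_v V) = τ_v(V′V)`: the perturbed configuration is translation
covariant (elementary API). -/
theorem pert_shiftE (v : Fin d → ℤ) (B' : ZdEdge d → 𝔸) (V : ZdEdge d → 𝔸ˣ) :
    pert (shiftE v B') (shiftE v V) = shiftE v (pert B' V) := by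
  funext b
  rfl

omit [NormOneClass 𝔸] in
/-- [cite: Balaban1987RG1, (2.17) p.269][cite: Balaban1987RG1, (2.4) p.266] **(2.4)'s `Q̃` IS TRANSLATION COVARIANT**
for [I]'s actual average: `Q̃_{τ_{La}V}(τ_{La}B′)(c) = Q̃_V(B′)(c + a)` — «By their definitions the expressions in
(2.1) are invariant with respect to these transformations» at the level of (2.4), exactly (no regularity needed),
from `B12Average012Periodicity.avgBar_shiftE`. -/
theorem Qtilde_shiftE (hL : 0 < L) (V : ZdEdge d → 𝔸ˣ) (B' : ZdEdge d → 𝔸) (a : Fin d → ℤ) (c : ZdEdge d) :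
    Qtilde L (fun U : ZdEdge d → 𝔸ˣ => Tavg L U) (shiftE ((L : ℤ) • a) V) (shiftE ((L : ℤ) • a) B') c
      = Qtilde L (fun U : ZdEdge d → 𝔸ˣ => Tavg L U) V B' (c.1 + a, c.2) := by
  unfold Qtilde
  rw [pert_shiftE]
  change (-Complex.I) • MatrixLog.mlog (((avgBar L (shiftE ((L : ℤ) • a) (pert B' V)) c
      * (avgBar L (shiftE ((L : ℤ) • a) V) c)⁻¹ : 𝔸ˣ) : 𝔸))
    = (-Complex.I) • MatrixLog.mlog (((avgBar L (pert B' V) (c.1 + a, c.2) * (avgBar L V (c.1 + a, c.2))⁻¹ : 𝔸ˣ) : 𝔸))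
  rw [avgBar_shiftE hL, avgBar_shiftE hL, shiftE_apply, shiftE_apply]

omit [NormOneClass 𝔸] in
/-- [cite: Balaban1987RG1, (2.17) p.269][cite: Balaban1987RG1, p.267] **THE LINEAR PART `LQ̃` IS TRANSLATION COVARIANT**:
`LQ̃_{τ_{La}V}(τ_{La}B′)(c) = LQ̃_V(B′)(c + a)` (exactly). -/
theorem LQ_shiftE (hL : 0 < L) (V : ZdEdge d → 𝔸ˣ) (B' : ZdEdge d → 𝔸) (a : Fin d → ℤ) (c : ZdEdge d) :
    LQ L (fun U : ZdEdge d → 𝔸ˣ => Tavg L U) (shiftE ((L : ℤ) • a) V) (shiftE ((L : ℤ) • a) B') c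
      = LQ L (fun U : ZdEdge d → 𝔸ˣ => Tavg L U) V B' (c.1 + a, c.2) := by
  unfold LQ
  have e : ∀ s : ℂ, s • shiftE ((L : ℤ) • a) B' = shiftE ((L : ℤ) • a) (s • B') := fun s => by
    funext b; rfl
  simp only [e, Qtilde_shiftE hL]

end Literature.MathematicalPhysics.QuantumFieldTheory.Balaban1983to89.B12Average012QtildeCovariance

end
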